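import Literature.AlgebraicGeometry.Motives.GrothendieckComplexFieldPointsCechProofs
import Literature.AlgebraicGeometry.Motives.TrivialLocusBaseChange
import HarnessLib

/-!
# Triviality of `𝒪(D)|_{P_t}` descends along field extensions: the trivial locus is compatible
# with every base change (Görtz–Wedhorn II, Lemma 24.65, Thm. 24.66 (1), (23.28.5))

`Motives/SeesawTheorem` defines the trivial locus `Z(D) = {t ∈ T ; 𝒪(D)|_{P_t} trivial}`
(`CartierDivisor.trivialLocus P T D`) of a Cartier divisor `D` on `P ×_K T`, `P → Spec K`
geometrically integral, through the fibres `P_t = P ×_K Spec κ(t)`, and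
`Motives/TrivialLocusBaseChange` proves the inclusion `g⁻¹ Z(D) ⊆ Z((P × g)^* D)` for a
`K`-morphism `g : T' → T` (with equality for open immersions). This file proves the reverse
inclusion for an ARBITRARY `g` when `P → Spec K` is proper, i.e. **the trivial locus is compatible
with base change** (Görtz–Wedhorn II, Thm. 24.66 (1): "as sets one has
`Z = {s ∈ S ; 𝓔_s is a free 𝒪_{X_s}-module}`" — a condition on the point alone). The fibre of
`(P × g)^* D` over `t'` is the base change of the fibre of `D` over `g(t')` along the field
extension `κ(g t') ⊆ κ(t')`, so the content is:

* `CartierDivisor.linEquiv_zero_of_classPullback_whiskerLeft_fieldExt` — **triviality of a divisor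
  class on `P_{L₀} = P ×_K Spec L₀` descends along every extension of fields `L₀ ⊆ L₁` over `K`**
  (`m : Spec L₁ → Spec L₀` a `K`-morphism, `F` on `P_{L₀}`: `F_{L₁} ∼ 0 ⇒ F ∼ 0`). Proof: by
  Görtz–Wedhorn II, Lemma 24.65 (`CartierDivisor.linEquiv_zero_of_isSection`,
  `Motives/CartierDivisorProperTrivial`) it suffices that `𝒪(F)` and `𝒪(-F)` have nonzero global
  sections, and **nonzero sections descend**
  (`CartierDivisor.exists_isSection_of_classPullback_whiskerLeft_fieldExt`): for the ordered Čech
  complex `Č•` of `𝒪(F)` over the affine base `Spec L₀` one has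
  `Γ(P_{L₁}, 𝒪(F_{L₁})) ≅ Ker(d⁰ ⊗ L₁)` and `Γ(P_{L₀}, 𝒪(F)) ≅ Ker(d⁰ ⊗ L₀)` — the named fact
  `cechComplex_h0_fieldPoint` (Görtz–Wedhorn II, (23.28.5)), PROVED in
  `Motives/GrothendieckComplexFieldPointsCechProofs`, at the field-valued points `m` and `id` of
  `Spec L₀` — and `Ker(d⁰ ⊗ L₁) = 0 ⇒ Ker(d⁰ ⊗ L₀) = 0` does not hold, rather
  `Ker(d⁰ ⊗ L₀) = 0 ⇒ Ker(d⁰ ⊗ L₁) = 0` (`L₁` is flat over the field `L₀`,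
  `injective_baseChange_of_isScalarTower_field`), i.e. `H⁰(P_{L₁}, 𝓛_{L₁}) = H⁰(P_{L₀}, 𝓛) ⊗ L₁`
  (cohomology and flat base change, Görtz–Wedhorn II, Cor. 22.91);
* `CartierDivisor.mem_trivialLocus_of_mem_trivialLocus_classPullback_whiskerLeft` —
  **`Z((P × g)^* D) ⊆ g⁻¹ Z(D)`**, and `CartierDivisor.preimage_trivialLocus_eq` —
  **`g⁻¹ Z(D) = Z((P × g)^* D)`**;
* plumbing: `evalAtFieldPoint` at the points `Spec(φ)` and `id` of the spectrum of a field
  (`evalAtFieldPoint_SpecMap_top`, `evalAtFieldPoint_id_top`; Mathlib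
  `Scheme.germ_stalkClosedPointTo_Spec`), and `-0 = 0` for Cartier divisors.

Consumer: the descent of the fibre condition `t ∈ Z(D)` along the stages of a limit
`Spec B = lim Spec K[t]` (`trivialLocus_descendsAlongStages`, hence
`theoremOfCube_noetherianDescent`, `Motives/TheoremOfCubeLimitProofs`): it descends to every stage.
Mathlib searched and used (pin): `Module.Flat.lTensor_preserves_injective_linearMap`,
`TensorProduct.AlgebraTensorModule.cancelBaseChange`, `lTensor_comp_cancelBaseChange`,
`Scheme.germ_stalkClosedPointTo_Spec`, `Spec.preimage`, `Spec.map_preimage`,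
`LinearEquiv.map_eq_zero_iff`, `Submodule.exists_mem_ne_zero_of_ne_bot`; Mathlib has no line
bundles on schemes, so the statements are in the divisor language of `Motives/CartierDivisor`.

## References

* U. Görtz, T. Wedhorn, *Algebraic Geometry II: Cohomology of Schemes*, Springer Spektrum (2023),
  doi:10.1007/978-3-658-43031-3: Cor. 22.91, p. 388; (23.28.5), p. 482; Lemma 24.65, p. 542;
  Thm. 24.66 (1), p. 543 (read via the held copy). [GortzWedhorn2023]
* U. Görtz, T. Wedhorn, *Algebraic Geometry I: Schemes*, 2nd ed. (2020): (11.9), p. 374;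
  Prop. 11.28, p. 379. [GortzWedhorn2020]
-/

universe u

open CategoryTheory CategoryTheory.Limits AlgebraicGeometry MonoidalCategory TensorProduct
open CartesianMonoidalCategory
open Literature.AlgebraicGeometry.Motives.RatFn

noncomputable section

namespace Literature.AlgebraicGeometry.Motives

/-! ### Injectivity after base change along a field extension -/

/-- **Injectivity survives a further base change along a field extension.** Let `A → L₀ → L₁`
be a tower of algebras with `L₀` a field, and `d : M → N` an `A`-linear map. If `d ⊗_A L₀` is
injective then so is `d ⊗_A L₁ = (d ⊗_A L₀) ⊗_{L₀} L₁` (`L₁` is free, hence flat, over the field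
`L₀`; Mathlib `Module.Flat.lTensor_preserves_injective_linearMap` and
`TensorProduct.AlgebraTensorModule.cancelBaseChange`). [folklore] -/
theorem injective_baseChange_of_isScalarTower_field {A L₀ L₁ : Type*} [CommRing A] [Field L₀]
    [CommRing L₁] [Algebra A L₀] [Algebra A L₁] [Algebra L₀ L₁] [IsScalarTower A L₀ L₁]
    {M N : Type*} [AddCommGroup M] [Module A M] [AddCommGroup N] [Module A N] (d : M →ₗ[A] N)
    (h : Function.Injective (d.baseChange L₀)) : Function.Injective (d.baseChange L₁) := by
  have h1 : Function.Injective ((d.baseChange L₀).baseChange L₁) :=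
    Module.Flat.lTensor_preserves_injective_linearMap (M := L₁) (d.baseChange L₀) h
  have hsq := TensorProduct.AlgebraTensorModule.lTensor_comp_cancelBaseChange
    (R := A) (A := L₀) (B := L₁) (M := L₁) (N := M) (Q := N) d
  have hsq' : ∀ x, d.baseChange L₁ (TensorProduct.AlgebraTensorModule.cancelBaseChange A L₀ L₁ L₁ M x) =
      TensorProduct.AlgebraTensorModule.cancelBaseChange A L₀ L₁ L₁ N
        ((d.baseChange L₀).baseChange L₁ x) := fun x =>
    LinearMap.congr_fun hsq x
  intro x y hxy
  obtain ⟨x, rfl⟩ := (TensorProduct.AlgebraTensorModule.cancelBaseChange A L₀ L₁ L₁ M).surjective x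
  obtain ⟨y, rfl⟩ := (TensorProduct.AlgebraTensorModule.cancelBaseChange A L₀ L₁ L₁ M).surjective y
  rw [hsq', hsq'] at hxy
  rw [h1 ((TensorProduct.AlgebraTensorModule.cancelBaseChange A L₀ L₁ L₁ N).injective hxy)]

/-- Contrapositive on kernels: if `Ker(d ⊗_A L₁) ≠ 0` then `Ker(d ⊗_A L₀) ≠ 0`. [folklore] -/
theorem ker_baseChange_ne_bot_of_isScalarTower_field {A L₀ L₁ : Type*} [CommRing A] [Field L₀]
    [CommRing L₁] [Algebra A L₀] [Algebra A L₁] [Algebra L₀ L₁] [IsScalarTower A L₀ L₁]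
    {M N : Type*} [AddCommGroup M] [Module A M] [AddCommGroup N] [Module A N] (d : M →ₗ[A] N)
    (h : LinearMap.ker (d.baseChange L₁) ≠ ⊥) : LinearMap.ker (d.baseChange L₀) ≠ ⊥ := fun h0 =>
  h (LinearMap.ker_eq_bot.2
    (injective_baseChange_of_isScalarTower_field d (LinearMap.ker_eq_bot.1 h0)))

/-! ### Evaluation at field-valued points of the spectrum of a field -/

/-- Evaluation at the `L`-valued point `Spec L → Spec R` given by `φ : R → L` is
`Γ(Spec R, 𝒪) = R → L`, `a ↦ φ(a)` (Mathlib `Scheme.germ_stalkClosedPointTo_Spec`). [folklore] -/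
theorem evalAtFieldPoint_SpecMap_top {R : CommRingCat.{u}} {L : Type u} [Field L]
    (φ : R ⟶ CommRingCat.of L)
    (h : (Spec.map φ) (IsLocalRing.closedPoint L) ∈ (⊤ : (Spec R).Opens)) (a : Γ(Spec R, ⊤)) :
    evalAtFieldPoint (Spec.map φ) ⊤ h a = φ.hom ((Scheme.ΓSpecIso R).hom.hom a) := by
  change ((Spec R).presheaf.germ ⊤ _ h ≫ Scheme.stalkClosedPointTo (Spec.map φ)).hom a = _
  rw [Scheme.germ_stalkClosedPointTo_Spec φ]
  rfl

/-- Evaluation at the identity point `Spec L → Spec L` is `Γ(Spec L, 𝒪) ≅ L`. [folklore] -/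
theorem evalAtFieldPoint_id_top {L : Type u} [Field L]
    (h : (𝟙 (Spec (.of L)) : Spec (.of L) ⟶ _) (IsLocalRing.closedPoint L) ∈
      (⊤ : (Spec (CommRingCat.of L)).Opens)) (a : Γ(Spec (.of L), ⊤)) :
    evalAtFieldPoint (𝟙 (Spec (.of L))) ⊤ h a = (Scheme.ΓSpecIso (.of L)).hom.hom a := by
  rw [evalAtFieldPoint_congr (Spec.map_id (CommRingCat.of L)).symm ⊤ h trivial,
    evalAtFieldPoint_SpecMap_top]
  rfl

/-! ### Descent of sections and of triviality along a field extension -/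

namespace CartierDivisor

section FieldExt

variable {K : Type u} [Field K] (P : SchemeOver K) [IsProper P.hom] [GeometricallyIntegral P.hom]
  {L₀ L₁ : Type u} [Field L₀] [Field L₁] {π₀ : Spec (.of L₀) ⟶ Spec (.of K)}
  {π₁ : Spec (.of L₁) ⟶ Spec (.of K)} (m : Over.mk π₁ ⟶ Over.mk π₀)

/-- **Nonzero sections descend along field extensions.** Let `P → Spec K` be proper and
geometrically integral, `L₀ → L₁` an extension of fields over `K` (a `K`-morphism
`m : Spec L₁ → Spec L₀`) and `F` a Cartier divisor on `P_{L₀} = P ×_K Spec L₀`. If the class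
pullback `F_{L₁}` of `F` along `P × m : P_{L₁} → P_{L₀}` has a nonzero global section, then so has
`F`: for the Čech complex `Č•` of `𝒪(F)` over the affine base `Spec L₀`,
`Γ(P_{L₁}, 𝒪(F_{L₁})) ≅ Ker(d⁰ ⊗ L₁)` and `Γ(P_{L₀}, 𝒪(F)) ≅ Ker(d⁰ ⊗ L₀)`
(`cechComplex_h0_fieldPoint` at the field-valued points `m` and `id` of `Spec L₀`;
Görtz–Wedhorn II, (23.28.5)), and `Ker(d⁰ ⊗ L₁) = Ker(d⁰ ⊗ L₀) ⊗_{L₀} L₁` (flat base change,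
`ker_baseChange_ne_bot_of_isScalarTower_field`) — i.e. `H⁰(P_{L₁}, 𝓛_{L₁}) = H⁰(P_{L₀}, 𝓛) ⊗_{L₀} L₁`
(Görtz–Wedhorn II, Cor. 22.91: cohomology and flat base change).
[cite: GortzWedhorn2023, (23.28.5) (p. 482) and Cor. 22.91 (p. 388)] -/
theorem exists_isSection_of_classPullback_whiskerLeft_fieldExt
    (F : CartierDivisor (P ⊗ Over.mk π₀).left)
    (h : ∃ s, s ≠ 0 ∧ (F.classPullback (P ◁ m).left).IsSection s) :
    ∃ s, s ≠ 0 ∧ F.IsSection s := by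
  haveI : IsIntegral (Over.mk π₀).left := inferInstanceAs (IsIntegral (Spec (.of L₀)))
  have hV : IsAffineOpen (⊤ : (Over.mk π₀).left.Opens) := isAffineOpen_top (Spec (.of L₀))
  haveI := quasiCompact_snd_left P (Over.mk π₀)
  obtain ⟨𝔚⟩ := CartierDivisor.CechCover.nonempty (snd P (Over.mk π₀)).left ⊤ F hV trivial
  -- the two field-valued points `id : Spec L₀ → Spec L₀` and `m : Spec L₁ → Spec L₀`
  have h0 : (𝟙 (Over.mk π₀) : Over.mk π₀ ⟶ Over.mk π₀).left (IsLocalRing.closedPoint L₀) ∈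
      (⊤ : (Over.mk π₀).left.Opens) := trivial
  have h1 : m.left (IsLocalRing.closedPoint L₁) ∈ (⊤ : (Over.mk π₀).left.Opens) := trivial
  letI i₀ := fibreOverField P π₀
  letI i₁ := fibreOverField P π₁
  letI a₀ : Algebra Γ((Over.mk π₀).left, (⊤ : (Over.mk π₀).left.Opens)) L₀ :=
    (evalAtFieldPoint (𝟙 (Over.mk π₀) : Over.mk π₀ ⟶ Over.mk π₀).left ⊤ h0).toAlgebra
  letI a₁ : Algebra Γ((Over.mk π₀).left, (⊤ : (Over.mk π₀).left.Opens)) L₁ :=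
    (evalAtFieldPoint m.left ⊤ h1).toAlgebra
  obtain ⟨e₀⟩ := cechComplex_h0_fieldPoint_holds K P (Over.mk π₀) F ⊤ hV 𝔚 L₀ π₀ (𝟙 _) h0
  obtain ⟨e₁⟩ := cechComplex_h0_fieldPoint_holds K P (Over.mk π₀) F ⊤ hV 𝔚 L₁ π₁ m h1
  -- the tower `Γ(Spec L₀, 𝒪) → L₀ → L₁`
  letI : Algebra L₀ L₁ := (Spec.preimage m.left).hom.toAlgebra
  haveI : IsScalarTower Γ((Over.mk π₀).left, (⊤ : (Over.mk π₀).left.Opens)) L₀ L₁ := by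
    refine IsScalarTower.of_algebraMap_eq fun a => ?_
    have eq1 := DFunLike.congr_fun (evalAtFieldPoint_congr (S := Spec (.of L₀))
      (Spec.map_preimage m.left).symm ⊤ h1 trivial) a
    have eq2 := evalAtFieldPoint_SpecMap_top (Spec.preimage m.left) trivial a
    have eq3 := evalAtFieldPoint_id_top h0 a
    exact eq1.trans (eq2.trans (congrArg (Spec.preimage m.left).hom eq3.symm))
  -- a nonzero section upstairs is a nonzero element of `Ker(d⁰ ⊗ L₁)`
  obtain ⟨s₁, hs₁0, hs₁⟩ := h
  have hk₁ : LinearMap.ker ((𝔚.complex.d 0 1).hom.baseChange L₁) ≠ ⊥ := by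
    intro hbot
    apply hs₁0
    have hk : e₁ ⟨s₁, hs₁⟩ = 0 := by
      apply Subtype.ext
      have hmem := LinearMap.mem_ker.1 (e₁ ⟨s₁, hs₁⟩).2
      exact LinearMap.ker_eq_bot.1 hbot (hmem.trans (map_zero _).symm)
    rw [LinearEquiv.map_eq_zero_iff] at hk
    exact congrArg Subtype.val hk
  -- hence `Ker(d⁰ ⊗ L₀) ≠ 0`: a nonzero section of `(P × id)^* F ∼ F`
  obtain ⟨x, hx, hx0⟩ := Submodule.exists_mem_ne_zero_of_ne_bot
    (ker_baseChange_ne_bot_of_isScalarTower_field (L₀ := L₀) _ hk₁)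
  have hy : e₀.symm ⟨x, hx⟩ ≠ 0 := fun hy =>
    hx0 (congrArg Subtype.val ((LinearEquiv.map_eq_zero_iff _).1 hy))
  have hsec : ∃ s, s ≠ 0 ∧ (F.classPullback (P ◁ 𝟙 (Over.mk π₀)).left).IsSection s :=
    ⟨(e₀.symm ⟨x, hx⟩).1, fun h0' => hy (Subtype.ext h0'), (e₀.symm ⟨x, hx⟩).2⟩
  have hid : (F.classPullback (P ◁ 𝟙 (Over.mk π₀)).left).LinEquiv F := by
    rw [classPullback_congr (show (P ◁ 𝟙 (Over.mk π₀)).left = 𝟙 _ by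
      rw [MonoidalCategory.whiskerLeft_id]; rfl)]
    exact F.classPullback_id_linEquiv
  exact hid.exists_isSection_iff.1 hsec

/-- `-0` is the zero divisor (local equations `1⁻¹ = 1`). [folklore] -/
theorem neg_zero_sameDivisor {X : Scheme.{u}} [IsIntegral X] :
    (-(0 : CartierDivisor X)).SameDivisor 0 := fun i j x _ _ => by
  rw [neg_f, zero_f, zero_f, inv_one, div_one]
  exact isUnitAt_one

/-- **Triviality of a divisor class on a proper geometrically integral scheme descends along
field extensions.** With `P`, `m : Spec L₁ → Spec L₀`, `F` as above: if `F_{L₁} ∼ 0` then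
`F ∼ 0`. Proof: `𝒪(F_{L₁})` and `𝒪(-F_{L₁}) ≅ 𝒪((-F)_{L₁})` have nonzero sections, hence so do
`𝒪(F)` and `𝒪(-F)` (`exists_isSection_of_classPullback_whiskerLeft_fieldExt`), and a line bundle on
the proper integral `L₀`-scheme `P_{L₀}` with `Γ(𝓛) ≠ 0 ≠ Γ(𝓛⁻¹)` is trivial (Görtz–Wedhorn II,
Lemma 24.65, `linEquiv_zero_of_isSection`). This is the set-theoretic content of Görtz–Wedhorn II,
Thm. 24.66 (1) ("as sets one has `Z = {s ∈ S ; 𝓔_s is a free 𝒪_{X_s}-module}`", a condition on the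
point `s` alone, independent of the field of definition of the fibre).
[cite: GortzWedhorn2023, Lemma 24.65 (p. 542) and Thm. 24.66 (1) (p. 543)] -/
theorem linEquiv_zero_of_classPullback_whiskerLeft_fieldExt
    (F : CartierDivisor (P ⊗ Over.mk π₀).left) (h : (F.classPullback (P ◁ m).left).LinEquiv 0) :
    F.LinEquiv 0 := by
  have hneg : ((-F).classPullback (P ◁ m).left).LinEquiv 0 :=
    (classPullback_neg_linEquiv _ F).trans (h.neg.trans neg_zero_sameDivisor.linEquiv)
  obtain ⟨s, hs0, hs⟩ :=
    exists_isSection_of_classPullback_whiskerLeft_fieldExt P m F h.exists_isSection.1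
  obtain ⟨t, ht0, ht⟩ :=
    exists_isSection_of_classPullback_whiskerLeft_fieldExt P m (-F) hneg.exists_isSection.1
  letI := fibreOverField P π₀
  haveI : UniversallyClosed ((P ⊗ Over.mk π₀).left ↘ Spec (.of L₀)) := by
    change UniversallyClosed (pullback.snd P.hom π₀)
    infer_instance
  exact linEquiv_zero_of_isSection L₀ hs0 hs ht0 ht

end FieldExt

/-! ### The trivial locus under an arbitrary base change -/

section BaseChange

variable {K : Type u} [Field K] (P : SchemeOver K) [IsProper P.hom] [GeometricallyIntegral P.hom]
  {T' T : SchemeOver K} [IsIntegral (P ⊗ T).left] [IsIntegral (P ⊗ T').left] (g : T' ⟶ T)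

/-- **`Z((P × g)^* D) ⊆ g⁻¹ Z(D)` for every `K`-morphism `g : T' → T`**: if `t'` lies in the trivial
locus of the base change `(P × g)^*D` then `g(t')` lies in the trivial locus of `D`. The fibre class
of `(P × g)^*D` at `t'` is the base change of the fibre class of `D` at `g(t')` along
`Spec κ(t') → Spec κ(g t')` (`residuePtMap`), and triviality descends along this field extension
(`linEquiv_zero_of_classPullback_whiskerLeft_fieldExt`). Together with
`mem_trivialLocus_classPullback_whiskerLeft` (`Motives/TrivialLocusBaseChange`): **the trivial locus
is compatible with base change**, `g⁻¹ Z(D) = Z((P × g)^* D)` (Görtz–Wedhorn II, Thm. 24.66 (1)),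
generalising `mem_trivialLocus_of_isOpenImmersion`.
[cite: GortzWedhorn2023, Thm. 24.66 (1) (p. 543), with Lemma 24.65 (p. 542)] -/
theorem mem_trivialLocus_of_mem_trivialLocus_classPullback_whiskerLeft
    {D : CartierDivisor (P ⊗ T).left} {t' : T'.left}
    (h : t' ∈ trivialLocus P T' (D.classPullback (P ◁ g).left)) :
    g.left t' ∈ trivialLocus P T D := by
  rw [mem_trivialLocus_iff] at h ⊢
  set F := D.classPullback (P ◁ residuePtι T (g.left t')).left
  -- the fibre class of `(P × g)^*D` at `t'` is `(P × residuePtMap)^* F`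
  have h1 : (F.classPullback (P ◁ residuePtMap g t').left).LinEquiv 0 := by
    refine ((classPullback_whiskerLeft_comp_linEquiv' P (residuePtι T (g.left t'))
      (residuePtMap g t') D).symm.trans ?_).trans h
    rw [residuePtMap_comp]
    exact classPullback_whiskerLeft_comp_linEquiv' P g (residuePtι T' t') D
  exact linEquiv_zero_of_classPullback_whiskerLeft_fieldExt P (residuePtMap g t') F h1

/-- **The trivial locus is compatible with base change** (Görtz–Wedhorn II, Thm. 24.66 (1)):
`g⁻¹ Z(D) = Z((P × g)^* D)` as subsets of `T'`, for every `K`-morphism `g : T' → T`.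
[cite: GortzWedhorn2023, Thm. 24.66 (1) (p. 543)] -/
theorem preimage_trivialLocus_eq (D : CartierDivisor (P ⊗ T).left) :
    g.left ⁻¹' trivialLocus P T D = trivialLocus P T' (D.classPullback (P ◁ g).left) :=
  Set.ext fun _ => ⟨fun h => mem_trivialLocus_classPullback_whiskerLeft P g h,
    fun h => mem_trivialLocus_of_mem_trivialLocus_classPullback_whiskerLeft P g h⟩

end BaseChange

end CartierDivisor

end Literature.AlgebraicGeometry.Motives

end
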